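import Summits.AtomisticToContinuum.Crystallization.Theorems.FreeSplittingCertificatesStrictSplittingRuleP1ReachNorm
import Summits.AtomisticToContinuum.Crystallization.Theorems.FreeSplittingCertificatesStrictSplittingRuleHcpShellMoments
import Summits.AtomisticToContinuum.Crystallization.Theorems.PalmUnimodularRigidityLayeredLawsSelectHcpReRoot
import Mathlib.LinearAlgebra.CrossProduct

/-!
# `StrictSplittingRule` (stmt-AtomisticToContinuum-12560): the LEDGER GAUGE — explicit least-squares co-rotation, gauge substitution and rigid-motion deflation of the near certificate (P1 interpolant object, part 106)

Route `FreeSplittingCertificates`, crux r3 `StrictSplittingRule` (H12⋆ = `stub_coreJointCoercive`), unit b2b-freesplit-B gen 52.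
VALUE = DEFINITIONS + structural lemmas for the kernel form of the (NC∃′) certificate TIERS (HOME `run/shared/lean/b2b/freesplit-r2/`, CERT §48).

The near certificate `nearcert.py` v10 (and its second transcription `fam51.py`) is a quadratic form in UNCONSTRAINED displacements
`u : ℤ³ → ℝ³` of the ledger site `p`: every term reads the GAUGE FUNCTIONALS `v_q(u) = u_q − u_p − W(u)(y_q − y_p)`, where `W(u)` is
the least-squares skew fit of the twelve first-shell relative displacements (`θ(u) = J⁻¹ Σ_{q ∈ shell} (y_q − y_p) × (u_q − u_p)`,
`J = Σ (‖d‖²I − ddᵀ) = diag(4a² + 6h², 4a² + 6h², 8a²)` for the hcp shell, `W(u)z = θ(u) × z`), plus the RIGID DEFLATION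
`γ Σ_{k<6} ⟨R_k, u⟩²/‖R_k‖²_G` over the active (touched) site set `S` (translations and the three scaled-frame rotations of nearcert,
here written in true coordinates).  The kernel statement (NC∃′) of `coreJointCoercive_cell_of_certificates₁₅` instead quantifies over lattice
values `V` on the least-squares CONSTRAINT SET (`V p = 0`, first-shell moment condition).  This file supplies the dictionary:
* `p1Rel`, `p1StarAt` — relative positions `y_q − y_p` (as `Fin 3 → ℝ`) and the first shell of `p` (either parity);
* `p1LSMoment`, `p1LSTheta`, `p1Vals` — the explicit least-squares co-rotation and the gauge substitution (the "gauge functionals" of nearcert) `u ↦ (v_q(u))_q`;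
* `p1Rigid` — the rigid fields `q ↦ t + ω × (y_q − y_p)`, parameters `c = (t, ω) : Fin 6 → ℝ`;
* `p1RigMom`, `p1RigNorm`, `p1Defl`, `p1NormSq` — nearcert's six deflation functionals, their `G`-normalisations, the deflation, `Σ_{q∈S}‖u_q‖²`;
* **`p1LedgerX`** — THE LEDGER FAMILY `X(a,h;u) = p1NearForm(…pinned data of …₁₅…, flux booked as (F₀, Δ) on the collar box)(v(u)) + p1Defl`:
  the kernel transcription of the v10 ledger `A(a,h) = NEAR − κ(F₀ + ΔG) + γ·RIGID` whose grid `LDLᵀ` certificates and box curvature bounds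
  are the two tiers of (NC∃′) (CERT §34 (h), §42, §43, §48);
* lemmas: `p1Vals_sub`, **`p1Vals_eq_self`** (on the constraint set the gauge substitution is the identity), `hcpShell_cross_cross`
  (`Σ_s y_s × (ω × y_s) = Jω`), **`p1Vals_p1Rigid`** (rigid fields are gauged to zero — the least-squares fit reproduces rotations exactly),
  `p1RigMom_sub`, `p1Defl_eq_zero_of_rigMom`, `p1Rigid_sub`.
NOT a proof of H12⋆, NOT summit progress.  [folklore: elementary least squares / rigid kinematics]
-/

noncomputable section

open scoped BigOperators Matrix
open Finset

namespace Summit.AtomisticToContinuum.Crystallization.Theorems.StrictSplittingRuleBirth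

open Literature.MathematicalPhysics.StatisticalMechanics
open Summit.AtomisticToContinuum.Crystallization.Theorems.PalmUnimodularRigidity.LayeredLawsSelectHcp

/-! ## Definitions -/

/-- Relative position `y_q − y_p` of the hcp sites, as a coordinate vector `Fin 3 → ℝ`. [folklore] -/
def p1Rel (a h : ℝ) (p q : ℤ × ℤ × ℤ) : Fin 3 → ℝ :=
  fun k => hcpSite a h q k - hcpSite a h p k

/-- The first shell (twelve nearest neighbours) of the site `p`: `hcpStarIdx + p` on an even layer, `p − hcpStarIdx` on an odd one
(the expression used verbatim by the endpoints `coreJointCoercive_cell_of_certificates₇…₁₅`). [folklore] -/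
def p1StarAt (p : ℤ × ℤ × ℤ) : Finset (ℤ × ℤ × ℤ) :=
  if Even p.1 then hcpStarIdx.image (fun d => d + p) else hcpStarIdx.image (fun d => p - d)

/-- Least-squares moment of a displacement field over the shell `SH` of `p`: `Σ_{q∈SH} (y_q − y_p) × (u_q − u_p)`. [folklore] -/
def p1LSMoment (a h : ℝ) (p : ℤ × ℤ × ℤ) (SH : Finset (ℤ × ℤ × ℤ)) (u : ℤ × ℤ × ℤ → (Fin 3 → ℝ)) : Fin 3 → ℝ :=
  ∑ q ∈ SH, (p1Rel a h p q) ⨯₃ (u q - u p)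

/-- The least-squares rotation vector `θ(u) = J⁻¹·(Σ d × (u_q − u_p))`, `J = diag(4a² + 6h², 4a² + 6h², 8a²)` (the hcp shell's
`Σ(‖d‖²I − ddᵀ)`). [folklore] -/
def p1LSTheta (a h : ℝ) (p : ℤ × ℤ × ℤ) (SH : Finset (ℤ × ℤ × ℤ)) (u : ℤ × ℤ × ℤ → (Fin 3 → ℝ)) : Fin 3 → ℝ :=
  fun k => (if k = 2 then (8 * a ^ 2)⁻¹ else (4 * a ^ 2 + 6 * h ^ 2)⁻¹) * p1LSMoment a h p SH u k

/-- **The gauge substitution**: `v_q(u) = u_q − u_p − θ(u) × (y_q − y_p)` — the lattice values the near ledger reads. [folklore] -/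
def p1Vals (a h : ℝ) (p : ℤ × ℤ × ℤ) (SH : Finset (ℤ × ℤ × ℤ)) (u : ℤ × ℤ × ℤ → (Fin 3 → ℝ)) :
    ℤ × ℤ × ℤ → (Fin 3 → ℝ) :=
  fun q => u q - u p - (p1LSTheta a h p SH u) ⨯₃ (p1Rel a h p q)

/-- The rigid displacement field with parameters `c = (t₀,t₁,t₂,ω₀,ω₁,ω₂)`: `q ↦ t + ω × (y_q − y_p)`. [folklore] -/
def p1Rigid (a h : ℝ) (p : ℤ × ℤ × ℤ) (c : Fin 6 → ℝ) : ℤ × ℤ × ℤ → (Fin 3 → ℝ) :=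
  fun q => ![c 0, c 1, c 2] + ![c 3, c 4, c 5] ⨯₃ (p1Rel a h p q)

/-- nearcert's six **deflation functionals** over the site set `S`, in true coordinates (`(x,y,z) = y_q − y_p`): the three component sums and
`Σ(z u_x − x u_z)`, `Σ(3y u_z − z u_y)`, `Σ(x u_y − 3y u_x)` (the scaled-frame "rotations" `(y₂,0,−y₀)`, `(0,−y₂,3y₁)`, `(−3y₁,y₀,0)` paired
with the scaled components). [folklore] -/
def p1RigMom (a h : ℝ) (p : ℤ × ℤ × ℤ) (S : Finset (ℤ × ℤ × ℤ)) (u : ℤ × ℤ × ℤ → (Fin 3 → ℝ)) : Fin 6 → ℝ :=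
  ![∑ q ∈ S, u q 0, ∑ q ∈ S, u q 1, ∑ q ∈ S, u q 2,
    ∑ q ∈ S, (p1Rel a h p q 2 * u q 0 - p1Rel a h p q 0 * u q 2),
    ∑ q ∈ S, (3 * p1Rel a h p q 1 * u q 2 - p1Rel a h p q 2 * u q 1),
    ∑ q ∈ S, (p1Rel a h p q 0 * u q 1 - 3 * p1Rel a h p q 1 * u q 0)]

/-- The `G`-normalisations `‖R_k‖²_G` of the six deflation functionals (`γ = 1`): `|S|, 9|S|, |S|, Σ(x²+z²), 9Σ(y²+z²), 9Σ(x²+y²)`. [folklore] -/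
def p1RigNorm (a h : ℝ) (p : ℤ × ℤ × ℤ) (S : Finset (ℤ × ℤ × ℤ)) : Fin 6 → ℝ :=
  ![(S.card : ℝ), 9 * (S.card : ℝ), (S.card : ℝ),
    ∑ q ∈ S, (p1Rel a h p q 0 ^ 2 + p1Rel a h p q 2 ^ 2),
    9 * ∑ q ∈ S, (p1Rel a h p q 1 ^ 2 + p1Rel a h p q 2 ^ 2),
    9 * ∑ q ∈ S, (p1Rel a h p q 0 ^ 2 + p1Rel a h p q 1 ^ 2)]

/-- **The rigid deflation** `Σ_{k<6} (R_k·u)²/‖R_k‖²_G` of nearcert v10 (group `rigid`, `γ = 1`) over the active site set `S`. [folklore] -/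
def p1Defl (a h : ℝ) (p : ℤ × ℤ × ℤ) (S : Finset (ℤ × ℤ × ℤ)) (u : ℤ × ℤ × ℤ → (Fin 3 → ℝ)) : ℝ :=
  ∑ k : Fin 6, p1RigMom a h p S u k ^ 2 / p1RigNorm a h p S k

/-- `Σ_{q∈S} ‖u_q‖²` — the metric `G` of the certificate on the active dofs (Euclidean in true coordinates). [folklore] -/
def p1NormSq (S : Finset (ℤ × ℤ × ℤ)) (u : ℤ × ℤ × ℤ → (Fin 3 → ℝ)) : ℝ :=
  ∑ q ∈ S, ∑ k : Fin 3, u q k ^ 2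

/-- **THE LEDGER FAMILY** of the near certificate at the representative `p`, as a function of the lattice parameters `(a,h)` and an
UNCONSTRAINED displacement field `u`: the finite near form of `coreJointCoercive_cell_of_certificates₁₅` with its pinned data (stencil `p1Stencil`,
line truss `p1Beta`, far shares `p1FarW/p1FarWv` of the shed set `p1Phi0`, reach set `p1QB` with the certified table `p1LU` — radial entry
normalised by `‖y_q − y_p‖²` —, payments `p1Paym`, legs `p1FarLegs`), the near tables `M₁, N` on `QT`, the collar flux BOOKED as the enclosure
form `(F₀, Δ)` on the vertex set of the collar box (`p1ScatterQF (p1CollarBox p)`), evaluated at the gauge values `p1Vals a h p (p1StarAt p) u`,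
PLUS nearcert's rigid deflation over the active site set `S`.  `X(a_i,h_j; ·) ⪰ m·p1NormSq S` is what the 162 grid ledgers certify;
`|∂²X/∂a²| ≤ B_aa·p1NormSq S`, `|∂²X/∂h²| ≤ B_hh·p1NormSq S` what the box tier certifies. [folklore] -/
def p1LedgerX (a h : ℝ) (p : ℤ × ℤ × ℤ) (M₁ N : Bool → (ℤ × ℤ × ℤ) → (ℤ × ℤ × ℤ) → (ℤ × ℤ × ℤ) → ℝ) (QT : Finset (ℤ × ℤ × ℤ))
    (F0 : (ℤ × ℤ × ℤ) × Fin 3 → (ℤ × ℤ × ℤ) × Fin 3 → ℝ) (Δ : (ℤ × ℤ × ℤ) → ℝ) (S : Finset (ℤ × ℤ × ℤ))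
    (u : ℤ × ℤ × ℤ → (Fin 3 → ℝ)) : ℝ :=
  p1NearForm a h (1 / 3) (1 / 12) (193 / 125) p p1Stencil (p1Beta a h) M₁ N (p1FarW a h (p1Phi0 p) p) p1SV (p1FarWv a h (p1Phi0 p) p)
      (fun s => -p1Beta a h (decide (Even p.1)) 0 s) (p1StarAt p) (p1QB p) QT (p1ScatterQF (p1CollarBox p)) (p1FarLegs (p1Phi0 p) p)
      (fun q => (p1LU p q).1 / ‖hcpSite a h q - hcpSite a h p‖ ^ 2) (fun q => (p1LU p q).2) (p1Paym p) Δ F0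
      (p1Vals a h p (p1StarAt p) u) +
    p1Defl a h p S u

/-! ## Linearity -/

/-- `p1Rel a h p p = 0`. -/
theorem p1Rel_self (a h : ℝ) (p : ℤ × ℤ × ℤ) : p1Rel a h p p = 0 := by
  funext k; simp [p1Rel]

/-- The least-squares moment is additive-subtractive in the field. -/
theorem p1LSMoment_sub (a h : ℝ) (p : ℤ × ℤ × ℤ) (SH : Finset (ℤ × ℤ × ℤ)) (u v : ℤ × ℤ × ℤ → (Fin 3 → ℝ)) :
    p1LSMoment a h p SH (u - v) = p1LSMoment a h p SH u - p1LSMoment a h p SH v := by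
  unfold p1LSMoment
  rw [← Finset.sum_sub_distrib]
  refine Finset.sum_congr rfl fun q _ => ?_
  have e : (u - v) q - (u - v) p = (u q - u p) - (v q - v p) := by
    simp only [Pi.sub_apply]; abel
  rw [e, map_sub]

/-- The least-squares rotation vector is subtractive in the field. -/
theorem p1LSTheta_sub (a h : ℝ) (p : ℤ × ℤ × ℤ) (SH : Finset (ℤ × ℤ × ℤ)) (u v : ℤ × ℤ × ℤ → (Fin 3 → ℝ)) :
    p1LSTheta a h p SH (u - v) = p1LSTheta a h p SH u - p1LSTheta a h p SH v := by
  funext k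
  simp only [p1LSTheta, p1LSMoment_sub, Pi.sub_apply]
  ring

/-- **The gauge substitution is linear** (subtractive form). -/
theorem p1Vals_sub (a h : ℝ) (p : ℤ × ℤ × ℤ) (SH : Finset (ℤ × ℤ × ℤ)) (u v : ℤ × ℤ × ℤ → (Fin 3 → ℝ)) :
    p1Vals a h p SH (u - v) = p1Vals a h p SH u - p1Vals a h p SH v := by
  funext q
  simp only [p1Vals, p1LSTheta_sub, Pi.sub_apply, map_sub, LinearMap.sub_apply]
  abel

/-- The gauge substitution is homogeneous. -/
theorem p1Vals_smul (a h : ℝ) (p : ℤ × ℤ × ℤ) (SH : Finset (ℤ × ℤ × ℤ)) (t : ℝ) (u : ℤ × ℤ × ℤ → (Fin 3 → ℝ)) :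
    p1Vals a h p SH (t • u) = t • p1Vals a h p SH u := by
  have hm : p1LSMoment a h p SH (t • u) = t • p1LSMoment a h p SH u := by
    unfold p1LSMoment
    rw [Finset.smul_sum]
    refine Finset.sum_congr rfl fun q _ => ?_
    have e : (t • u) q - (t • u) p = t • (u q - u p) := by
      simp only [Pi.smul_apply, smul_sub]
    rw [e, map_smul]
  have hθ : p1LSTheta a h p SH (t • u) = t • p1LSTheta a h p SH u := by
    funext k
    simp only [p1LSTheta, hm, Pi.smul_apply, smul_eq_mul]
    ring
  funext q
  simp only [p1Vals, hθ, Pi.smul_apply, map_smul, LinearMap.smul_apply, smul_sub]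

/-- The deflation functionals are subtractive. -/
theorem p1RigMom_sub (a h : ℝ) (p : ℤ × ℤ × ℤ) (S : Finset (ℤ × ℤ × ℤ)) (u v : ℤ × ℤ × ℤ → (Fin 3 → ℝ)) :
    p1RigMom a h p S (u - v) = p1RigMom a h p S u - p1RigMom a h p S v := by
  funext k
  fin_cases k <;>
    simp only [p1RigMom, Pi.sub_apply, Fin.isValue, Matrix.cons_val_zero, Matrix.cons_val_one, Matrix.cons_val,
      Fin.zero_eta, Fin.mk_one, Fin.reduceFinMk, ← Finset.sum_sub_distrib] <;>
    exact Finset.sum_congr rfl fun q _ => by ring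

/-- The deflation functionals are homogeneous. -/
theorem p1RigMom_smul (a h : ℝ) (p : ℤ × ℤ × ℤ) (S : Finset (ℤ × ℤ × ℤ)) (t : ℝ) (u : ℤ × ℤ × ℤ → (Fin 3 → ℝ)) :
    p1RigMom a h p S (t • u) = t • p1RigMom a h p S u := by
  funext k
  fin_cases k <;>
    simp only [p1RigMom, Pi.smul_apply, smul_eq_mul, Fin.isValue, Matrix.cons_val_zero, Matrix.cons_val_one, Matrix.cons_val,
      Fin.zero_eta, Fin.mk_one, Fin.reduceFinMk, Finset.mul_sum] <;>
    exact Finset.sum_congr rfl fun q _ => by ring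

/-- The deflation vanishes when the six functionals do. -/
theorem p1Defl_eq_zero_of_rigMom (a h : ℝ) (p : ℤ × ℤ × ℤ) (S : Finset (ℤ × ℤ × ℤ)) {u : ℤ × ℤ × ℤ → (Fin 3 → ℝ)}
    (hu : p1RigMom a h p S u = 0) : p1Defl a h p S u = 0 := by
  unfold p1Defl
  simp [hu]

/-- The deflation is nonnegative whenever its normalisations are (they are: cardinalities and sums of squares). -/
theorem p1Defl_nonneg (a h : ℝ) (p : ℤ × ℤ × ℤ) (S : Finset (ℤ × ℤ × ℤ)) (u : ℤ × ℤ × ℤ → (Fin 3 → ℝ)) :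
    0 ≤ p1Defl a h p S u := by
  unfold p1Defl
  refine Finset.sum_nonneg fun k _ => div_nonneg (sq_nonneg _) ?_
  fin_cases k <;> simp only [p1RigNorm, Fin.isValue, Matrix.cons_val_zero, Matrix.cons_val_one, Matrix.cons_val,
      Fin.zero_eta, Fin.mk_one, Fin.reduceFinMk] <;> positivity

/-- `Σ_{q∈S}‖u_q‖² ≥ 0`. -/
theorem p1NormSq_nonneg (S : Finset (ℤ × ℤ × ℤ)) (u : ℤ × ℤ × ℤ → (Fin 3 → ℝ)) : 0 ≤ p1NormSq S u :=
  Finset.sum_nonneg fun _ _ => Finset.sum_nonneg fun _ _ => sq_nonneg _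

/-- `Σ_{q∈S}‖t u_q‖² = t² Σ_{q∈S}‖u_q‖²`. -/
theorem p1NormSq_smul (S : Finset (ℤ × ℤ × ℤ)) (t : ℝ) (u : ℤ × ℤ × ℤ → (Fin 3 → ℝ)) :
    p1NormSq S (t • u) = t ^ 2 * p1NormSq S u := by
  unfold p1NormSq
  rw [Finset.mul_sum]
  refine Finset.sum_congr rfl fun q _ => ?_
  rw [Finset.mul_sum]
  exact Finset.sum_congr rfl fun k _ => by simp only [Pi.smul_apply, smul_eq_mul]; ring

/-- If `Σ_{q∈S}‖u_q‖² = 0` then `u` vanishes on `S`. -/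
theorem eq_zero_of_p1NormSq_eq_zero {S : Finset (ℤ × ℤ × ℤ)} {u : ℤ × ℤ × ℤ → (Fin 3 → ℝ)} (h0 : p1NormSq S u = 0)
    {q : ℤ × ℤ × ℤ} (hq : q ∈ S) : u q = 0 := by
  unfold p1NormSq at h0
  have h1 := (Finset.sum_eq_zero_iff_of_nonneg (fun q _ => Finset.sum_nonneg fun k _ => sq_nonneg (u q k))).1 h0 q hq
  have h2 := (Finset.sum_eq_zero_iff_of_nonneg (fun k _ => sq_nonneg (u q k))).1 h1
  funext k
  exact pow_eq_zero_iff (n := 2) (by norm_num) |>.1 (h2 k (Finset.mem_univ k))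

/-- The rigid fields are subtractive in their parameters. -/
theorem p1Rigid_sub (a h : ℝ) (p : ℤ × ℤ × ℤ) (c c' : Fin 6 → ℝ) :
    p1Rigid a h p (c - c') = p1Rigid a h p c - p1Rigid a h p c' := by
  funext q
  have e1 : (![c 0 - c' 0, c 1 - c' 1, c 2 - c' 2] : Fin 3 → ℝ) = ![c 0, c 1, c 2] - ![c' 0, c' 1, c' 2] := by
    ext k; fin_cases k <;> simp
  have e2 : (![c 3 - c' 3, c 4 - c' 4, c 5 - c' 5] : Fin 3 → ℝ) = ![c 3, c 4, c 5] - ![c' 3, c' 4, c' 5] := by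
    ext k; fin_cases k <;> simp
  simp only [p1Rigid, Pi.sub_apply]
  rw [e1, e2, map_sub, LinearMap.sub_apply]
  abel

/-- The rigid fields are homogeneous in their parameters. -/
theorem p1Rigid_smul (a h : ℝ) (p : ℤ × ℤ × ℤ) (t : ℝ) (c : Fin 6 → ℝ) :
    p1Rigid a h p (t • c) = t • p1Rigid a h p c := by
  funext q
  have e1 : (![t • c 0, t • c 1, t • c 2] : Fin 3 → ℝ) = t • ![c 0, c 1, c 2] := by
    ext k; fin_cases k <;> simp
  have e2 : (![t • c 3, t • c 4, t • c 5] : Fin 3 → ℝ) = t • ![c 3, c 4, c 5] := by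
    ext k; fin_cases k <;> simp
  simp only [p1Rigid, Pi.smul_apply]
  rw [e1, e2, map_smul, LinearMap.smul_apply, smul_add]

/-! ## On the constraint set the gauge substitution is the identity -/

/-- The three components of the least-squares moment are the values of the first-shell moment functional at the three elementary
antisymmetric matrices. -/
theorem p1LSMoment_eq_zero_of_moment {a h : ℝ} {p : ℤ × ℤ × ℤ} {SH : Finset (ℤ × ℤ × ℤ)} {V : ℤ × ℤ × ℤ → (Fin 3 → ℝ)}
    (hV : V p = 0)
    (hmom : ∀ Z : Fin 3 → Fin 3 → ℝ, (∀ j k, Z j k = -Z k j) →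
      ∑ q ∈ SH, ∑ k : Fin 3, V q k * (∑ j : Fin 3, (hcpSite a h q j - hcpSite a h p j) * Z j k) = 0) :
    p1LSMoment a h p SH V = 0 := by
  -- the three elementary antisymmetric matrices
  have h0 := hmom (fun j k => if j = 1 ∧ k = 2 then 1 else if j = 2 ∧ k = 1 then -1 else 0)
    (by intro j k; fin_cases j <;> fin_cases k <;> simp)
  have h1 := hmom (fun j k => if j = 2 ∧ k = 0 then 1 else if j = 0 ∧ k = 2 then -1 else 0)
    (by intro j k; fin_cases j <;> fin_cases k <;> simp)
  have h2 := hmom (fun j k => if j = 0 ∧ k = 1 then 1 else if j = 1 ∧ k = 0 then -1 else 0)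
    (by intro j k; fin_cases j <;> fin_cases k <;> simp)
  simp only [Fin.sum_univ_three, Fin.isValue] at h0 h1 h2
  funext i
  unfold p1LSMoment
  rw [Finset.sum_apply]
  simp only [hV, sub_zero, Pi.zero_apply]
  fin_cases i
  · simp only [Fin.zero_eta, Fin.isValue, cross_apply, Matrix.cons_val_zero, p1Rel]
    rw [← h0]
    refine Finset.sum_congr rfl fun q _ => ?_
    simp; ring
  · simp only [Fin.mk_one, Fin.isValue, cross_apply, Matrix.cons_val_one, Matrix.cons_val_zero, p1Rel]
    rw [← h1]
    refine Finset.sum_congr rfl fun q _ => ?_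
    simp; ring
  · simp only [Fin.reduceFinMk, Fin.isValue, cross_apply, Matrix.cons_val, p1Rel]
    rw [← h2]
    refine Finset.sum_congr rfl fun q _ => ?_
    simp; ring

/-- **On the least-squares constraint set the gauge substitution is the identity**: `V p = 0` and the first-shell moment condition give
`p1Vals a h p SH V = V` (the explicit rotation vector `θ(V) = J⁻¹·0` vanishes). [folklore] -/
theorem p1Vals_eq_self {a h : ℝ} {p : ℤ × ℤ × ℤ} {SH : Finset (ℤ × ℤ × ℤ)} {V : ℤ × ℤ × ℤ → (Fin 3 → ℝ)}
    (hV : V p = 0)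
    (hmom : ∀ Z : Fin 3 → Fin 3 → ℝ, (∀ j k, Z j k = -Z k j) →
      ∑ q ∈ SH, ∑ k : Fin 3, V q k * (∑ j : Fin 3, (hcpSite a h q j - hcpSite a h p j) * Z j k) = 0) :
    p1Vals a h p SH V = V := by
  have hm := p1LSMoment_eq_zero_of_moment hV hmom
  have hθ : p1LSTheta a h p SH V = 0 := by
    funext k; simp [p1LSTheta, hm]
  funext q
  simp only [p1Vals, hθ, map_zero, LinearMap.zero_apply, sub_zero, hV]

/-! ## Rigid fields are gauged to zero -/

/-- **The shell identity behind the explicit least-squares inverse**: `Σ_{s ∈ hcpStarIdx} y_s × (ω × y_s) = Jω` with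
`J = diag(4a² + 6h², 4a² + 6h², 8a²)` (`= Σ‖y_s‖²·I − Σ y_s y_sᵀ`, second moments `diag(4a², 4a², 6h²)`). [folklore] -/
theorem hcpShell_cross_cross (a h : ℝ) (ω : Fin 3 → ℝ) :
    ∑ s ∈ hcpStarIdx, (fun k => hcpSite a h s k) ⨯₃ (ω ⨯₃ (fun k => hcpSite a h s k)) =
      ![(4 * a ^ 2 + 6 * h ^ 2) * ω 0, (4 * a ^ 2 + 6 * h ^ 2) * ω 1, 8 * a ^ 2 * ω 2] := by
  obtain ⟨l0, l1, lm1⟩ := hcpShell_labels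
  have h3 : (√3 : ℝ) ^ 2 = 3 := Real.sq_sqrt (by norm_num)
  rw [hcpShell_sum_expand]
  ext i
  fin_cases i
  · simp only [cross_apply, hcpSite_apply_zero, hcpSite_apply_one, hcpSite_apply_two, l0, l1, lm1, Fin.isValue,
      Matrix.cons_val_zero, Matrix.cons_val_one, Matrix.cons_val, Pi.add_apply, Fin.zero_eta]
    push_cast
    linear_combination (4 / 3 * a ^ 2 * ω 0) * h3
  · simp only [cross_apply, hcpSite_apply_zero, hcpSite_apply_one, hcpSite_apply_two, l0, l1, lm1, Fin.isValue,
      Matrix.cons_val_zero, Matrix.cons_val_one, Matrix.cons_val, Pi.add_apply, Fin.mk_one]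
    push_cast
    ring
  · simp only [cross_apply, hcpSite_apply_zero, hcpSite_apply_one, hcpSite_apply_two, l0, l1, lm1, Fin.isValue,
      Matrix.cons_val_zero, Matrix.cons_val_one, Matrix.cons_val, Pi.add_apply, Fin.reduceFinMk]
    push_cast
    linear_combination (4 / 3 * a ^ 2 * ω 2) * h3

/-- **The shell of `p` at either parity realises the root shell up to sign**, so `Σ_{q ∈ p1StarAt p} d_q × (ω × d_q) = Jω`
(`d_q = y_q − y_p = ±y_s`; the summand is even in `d_q`). [folklore] -/
theorem p1StarAt_cross_cross (a h : ℝ) (p : ℤ × ℤ × ℤ) (ω : Fin 3 → ℝ) :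
    ∑ q ∈ p1StarAt p, (p1Rel a h p q) ⨯₃ (ω ⨯₃ (p1Rel a h p q)) =
      ![(4 * a ^ 2 + 6 * h ^ 2) * ω 0, (4 * a ^ 2 + 6 * h ^ 2) * ω 1, 8 * a ^ 2 * ω 2] := by
  rw [← hcpShell_cross_cross a h ω]
  unfold p1StarAt
  split_ifs with hp
  · rw [Finset.sum_image (fun x _ y _ hxy => add_right_cancel hxy)]
    refine Finset.sum_congr rfl fun d _ => ?_
    have e : p1Rel a h p (d + p) = fun k => hcpSite a h d k := by
      funext k
      simp only [p1Rel]
      rw [add_comm d p, hcpSite_add_of_even a h hp d]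
      simp
    rw [e]
  · have hp' : Odd p.1 := Int.not_even_iff_odd.1 hp
    rw [Finset.sum_image (fun x _ y _ hxy => sub_right_injective hxy)]
    refine Finset.sum_congr rfl fun d _ => ?_
    have e : p1Rel a h p (p - d) = -(fun k => hcpSite a h d k) := by
      funext k
      simp only [p1Rel, Pi.neg_apply]
      rw [hcpSite_sub_of_odd a h hp' d]
      simp
    rw [e, map_neg, LinearMap.neg_apply, map_neg, map_neg, neg_neg]

/-- The least-squares moment of a rigid field over the shell of `p` is `Jω`. -/
theorem p1LSMoment_p1Rigid (a h : ℝ) (p : ℤ × ℤ × ℤ) (c : Fin 6 → ℝ) :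
    p1LSMoment a h p (p1StarAt p) (p1Rigid a h p c) =
      ![(4 * a ^ 2 + 6 * h ^ 2) * c 3, (4 * a ^ 2 + 6 * h ^ 2) * c 4, 8 * a ^ 2 * c 5] := by
  have key := p1StarAt_cross_cross a h p ![c 3, c 4, c 5]
  simp only [Matrix.cons_val_zero, Matrix.cons_val_one, Matrix.cons_val, Fin.isValue] at key
  rw [← key]
  unfold p1LSMoment
  refine Finset.sum_congr rfl fun q _ => ?_
  have e : p1Rigid a h p c q - p1Rigid a h p c p = ![c 3, c 4, c 5] ⨯₃ (p1Rel a h p q) := by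
    simp only [p1Rigid, p1Rel_self, map_zero, add_zero]
    abel
  rw [e]

/-- **Rigid fields are gauged to zero**: the explicit least-squares fit reproduces every infinitesimal rotation of the shell exactly
(`θ(t + ω × d) = J⁻¹Jω = ω`), hence `v_q(t + ω × d) = ω × d_q − ω × d_q = 0`.  Needs `a ≠ 0` (invertibility of `J`). [folklore] -/
theorem p1Vals_p1Rigid {a h : ℝ} (ha : 0 < a) (p : ℤ × ℤ × ℤ) (c : Fin 6 → ℝ) :
    p1Vals a h p (p1StarAt p) (p1Rigid a h p c) = 0 := by
  have hJ1 : (4 * a ^ 2 + 6 * h ^ 2) ≠ 0 := by positivity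
  have hJ2 : (8 * a ^ 2) ≠ 0 := by positivity
  have hθ : p1LSTheta a h p (p1StarAt p) (p1Rigid a h p c) = ![c 3, c 4, c 5] := by
    funext k
    simp only [p1LSTheta, p1LSMoment_p1Rigid]
    fin_cases k
    · simp only [Fin.zero_eta, Fin.isValue, Matrix.cons_val_zero]
      rw [if_neg (by decide)]; field_simp
    · simp only [Fin.mk_one, Fin.isValue, Matrix.cons_val_one, Matrix.cons_val_zero]
      rw [if_neg (by decide)]; field_simp
    · simp only [Fin.reduceFinMk, Fin.isValue, Matrix.cons_val, if_true]
      field_simp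
  funext q
  simp only [p1Vals, hθ, p1Rigid, p1Rel_self, map_zero, add_zero, Pi.zero_apply]
  abel

end Summit.AtomisticToContinuum.Crystallization.Theorems.StrictSplittingRuleBirth

end
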